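import Summits.Ventures.PackingBounds.ThreePointCert.SoundNN
import Summits.Ventures.PackingBounds.ThreePointCert.CheckKS
import Summits.Ventures.PackingBounds.ThreePointCert.CheckFastFZ
import Summits.Ventures.PackingBounds.ThreePointCert.K10d12ExpandKS1
import Summits.Ventures.PackingBounds.ThreePointCert.K10d12ExpandKS2
import Summits.Ventures.PackingBounds.ThreePointCert.K10d12ExpandKS3
import Summits.Ventures.PackingBounds.ThreePointCert.K10d12ExpandQG1
import Summits.Ventures.PackingBounds.ThreePointCert.K10d12ExpandQG2
import Summits.Ventures.PackingBounds.ThreePointCert.K10d12ExpandQG3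
import Summits.Ventures.PackingBounds.ThreePointCert.K10d12CheckA
import Summits.Ventures.PackingBounds.ThreePointCert.K10d12CheckB

/-!
# κ(10) ≤ 556: the kernel-checked theorem

Framing: lottery ticket; floor = certified bounds/negative ranges. Venture `PackingBounds` (cell
`pub-packcert`), three-point SDP family, kissing column. Integer data / kernel checks of a feasible point of the
Bachoc–Vallentin semidefinite program (n = 10, s = 1/2, three-point matrix degree 12, two-point (Gegenbauer) part to
degree L = 24, Bachoc–Vallentin multiplier set = cell mode sym2; exact rational certificate `sdp-n10-d12-s1-2-sym2-a24-hyb7-j143228.json`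
(sha256 ec3df9a54f2f215f2d69b4ef79b85f5fd23fd5faa12cd7f670a7d0c251362865) of the sdp seat's hybrid pipeline, verified by the cell's two exact verifiers), converted by
`cert2lean_g9.py` (lp gen 9; S = 64) into the units of the kernel checker `ThreePointCert.Check` + `CheckSym2` with the
record degree field set to L = 24 (the checker's degree enters only the unit `W = 2^d·d!` and the side conditions, so a
(d, L) certificate is a `Cert3` of degree L); Gram factor COLUMNS offset-encoded for the Kronecker-substitution validation
`ThreePointCert.CheckKS` (`sosCheckKS`: the claimed expansion and `Σ_k col_k²` compared at the point `(2^w, 2^{wD}, 2^{wD²})`); split check of (ii') `ThreePointCert.CheckSym2Split`.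
Emitter `emitlean_ks.py` (lp gen 10; coarse Gram factors `L′ ≈ L/2^k`, expansions `4^k • zᵀ(L′L′ᵀ)z` lifted by `SoundNN.boxNonneg_smul` as in lp gen 9's v3s). Generated file: plain lists of integers / monomials.
-/

namespace Summit.Ventures.PackingBounds.ThreePointCert.K10d12

open Literature.Geometry.DiscreteGeometry Literature.Geometry.DiscreteGeometry.PolyCert PolyCert.SPoly

set_option maxRecDepth 100000 in
/-- The expansion data are valid in the weak sense of `SoundNN.PolysNN3` (Gram expansions by `CheckKS.boxNonneg_of_sosCheckKS`, scaled by `boxNonneg_smul`; `FI` by the chunk validations). -/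
theorem polys_nn : PolysNN3 K10d12.cert K10d12.polys where
  hF := fexpValidG_of_fchunkVal cert eFP _ (by rfl) (fchunkVal_append _ _ _ _ _ _ (fchunkVal_append _ _ _ _ _ _ (fchunkVal_append _ _ _ _ _ _ (fchunkVal_append _ _ _ _ _ _ (fchunkVal_append _ _ _ _ _ _ (fchunkVal_append _ _ _ _ _ _ (fchunkVal_append _ _ _ _ _ _ (fchunkVal_append _ _ _ _ _ _ (fchunkVal_append _ _ _ _ _ _ (fchunkVal_append _ _ _ _ _ _ (fchunkVal_append _ _ _ _ _ _ (fchunkVal_of_okFZ _ _ _ _ okF_1) (fchunkVal_of_okFZ _ _ _ _ okF_2)) (fchunkVal_of_okFZ _ _ _ _ okF_3)) (fchunkVal_of_okFZ _ _ _ _ okF_4)) (fchunkVal_of_okFZ _ _ _ _ okF_5)) (fchunkVal_of_okFZ _ _ _ _ okF_6)) (fchunkVal_of_okFZ _ _ _ _ okF_7)) (fchunkVal_of_okFZ _ _ _ _ okF_8)) (fchunkVal_of_okFZ _ _ _ _ okF_9)) (fchunkVal_of_okFZ _ _ _ _ okF_10)) (fchunkVal_of_okFZ _ _ _ _ okF_11))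 (fchunkVal_of_okFZ _ _ _ _ okF_12))
  h0 := boxNonneg_smul cR0 eR0s (boxNonneg_of_sosCheckKS _ _ _ _ _ _ _ _ vR0)
  h1 := boxNonneg_smul cR1 eR1s (boxNonneg_of_sosCheckKS _ _ _ _ _ _ _ _ vR1)
  h2 := boxNonneg_smul cR2 eR2s (boxNonneg_of_sosCheckKS _ _ _ _ _ _ _ _ vR2)
  h3 := boxNonneg_smul cR3 eR3s (boxNonneg_of_sosCheckKS _ _ _ _ _ _ _ _ vR3)
  h4 := boxNonneg_smul cR4 eR4s (boxNonneg_of_sosCheckKS _ _ _ _ _ _ _ _ vR4)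
  hq0 := boxNonneg_smul cQ0 eQ0s (boxNonneg_of_sosCheckKS _ _ _ _ _ _ _ _ vQ0)
  hq1 := boxNonneg_smul cQ1 eQ1s (boxNonneg_of_sosCheckKS _ _ _ _ _ _ _ _ vQ1)

set_option maxHeartbeats 0 in
/-- The side conditions hold. -/
theorem cert_side : checkSide3 K10d12.cert = true := by decide +kernel

set_option maxHeartbeats 0 in
/-- The numerical bound is `< N + 1` (and `≥ 0`). -/
theorem cert_bound : checkBound3 K10d12.cert K10d12.polys = true := by decide +kernel

/-- **κ(10) ≤ 556**: every finite set of unit vectors of `ℝ^10` with pairwise inner products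
`≤ 1 / 2` has at most `556` elements (kissing configurations of `ℝ^10`) — the Bachoc–Vallentin three-point (semidefinite
programming) bound with their original multiplier set, three-point matrix degree 12 with the two-point (Gegenbauer)
part to degree 24 (the sdp seat's hybrid pipeline, cell family hyb7), from the exact certificate
`sdp-n10-d12-s1-2-sym2-a24-hyb7-j143228.json` (bound value 556.358290), kernel-checked (record degree field `d := 24`; split check of (ii'); coarse Gram factors lifted by `SoundNN`; Gram expansions by Kronecker substitution `CheckKS`).
[cite: BachocVallentin2007, Theorem 4.2] -/
theorem kissing_dim10_le_556_sdp (C : Finset (EuclideanSpace ℝ (Fin 10)))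
    (h1 : ∀ x ∈ C, ‖x‖ = 1) (h2 : ∀ x ∈ C, ∀ y ∈ C, x ≠ y → inner ℝ x y ≤ 1 / 2) :
    C.card ≤ 556 :=
  card_le_of_cert3S2splitNN cert polys polys_nn cert_I polyM polyMM cert_IIa cert_IIb cert_IIc cert_side cert_bound C h1
    (fun x hx y hy hxy => by
      have h := h2 x hx y hy hxy
      have e : ((cert.p : ℤ) : ℝ) / (cert.q : ℕ) = 1 / 2 := by norm_num [cert]
      rw [e]; exact h)

end Summit.Ventures.PackingBounds.ThreePointCert.K10d12
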